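import Summits.BirchSwinnertonDyer.BirchSwinnertonDyer.Theorems.SchneiderFreeAdditiveX3KrizLiLocusLValueFree
import Summits.BirchSwinnertonDyer.BirchSwinnertonDyer.Theorems.PrintCFramBottomClassIndexLawFiveLeOffLocusDictionary
import Literature.NumberTheory.EllipticCurves.KrizLi2019.ThreeIsogenyHeegnerFieldSupply
import Literature.NumberTheory.EllipticCurves.HeegnerHypothesisKroneckerProofs
import HarnessLib

/-!
# Route `SchneiderFreeAdditiveX3` (K1 door), the Kriz–Li road at `p = 3` PER HEEGNER FIELD with a CLASS-NUMBER certificate: the leaf's body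
# `MissingLowerBoundAt W 3` from `PrintedFacts`, Kriz–Li 2019 Thm. 1.20 and §8, the character data, ONE Heegner field `K` of `N_W` with odd
# `d_K`, and `3 ∤ h` of two imaginary quadratic fields — no Bernoulli number, no `L`-value, no Heegner point among the hypotheses

Cell `bsd-schneider-ideate`, seat `bsd-schneider-door-c5` (prover, generation 36; leaf load-bearing, `--supports` 19177 as helper).
PARTITION: board row B6 ∩ X3 ∩ sst-twist, `r = 1`, `p = 3`, the Kriz–Li locus (Thm. 7.1 (1)–(3): 24 of the 6 794 door pairs at `p = 3`,
door-c2 g7 kit j260994 = this seat's kit j335581) of `Rank1Residual.partition`; types-the-object-of nothing new; closes none of B6's cells;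
BSD NOT advanced; «closes rung: none».  bears_on: K1-door (rung leaf `SchneiderFree.AdditiveX3RankOneLower`, its body at these pairs).

WHY.  Generation 36's `KrizLiLocusLValueFree` reduced the per-pair input of the Kriz–Li road to a Heegner FIELD `K` (odd `d_K`) and
Kriz–Li's Bernoulli hypothesis (4); at `p = 3` the typed §8 of Kriz–Li (`KrizLi2019.cor83_bernoulli_unit_three_of_h3`: the class number
formula (35) with Lemma 8.2 / Cor. 8.3) converts (4) into `3 ∤ h(K_{ψ₀ε_K})·h(K_{ψ₀⁻¹ω})` — two imaginary QUADRATIC class numbers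
(`ψ` is quadratic at `p = 3`).  So the per-pair certificate at `p = 3` is `(K; h(D₁), h(D₂))`, `D₁, D₂ ∈ {f·d_K, −3f}` (`ψ` even) or
`{−f, 3·f·d_K}` (`ψ` odd), `f` the conductor of `ψ` — exact integer arithmetic.  Door-c2 g7's census found such a `K` among the first twelve
Heegner fields of the door at ALL 24 pairs of the `p = 3` locus (`c123&someK4 = 24`), computing (4) exactly by these class numbers; the
analytic conjunct `L(W^{(d_K)}, 1) ≠ 0` it could not compute at those conductors is no longer an input (generation 36, F25b).

WHAT.  `missingLowerBoundAt_three_of_printedFacts_of_thm120_of_heegnerField_h3`: `W` on the door at `p = 3`, character data `(f, ψ, ω)`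
(`ψ` quadratic primitive supported on `3N_W`, `ω` Teichmüller, trace form, Thm. 7.1 (1)–(3)), an imaginary quadratic `K` with odd `d_K`
satisfying the Heegner hypothesis for `N_W`, and the two class-number conditions ⟹ `MissingLowerBoundAt W 3`.  PROOF: `3 ∣ N_W` and the primes
of `f` divide `3N_W`, so they split in `K`: `3 ∤ d_K`, `(f, d_K) = 1` (`SatisfiesHeegnerHypothesis.not_dvd_discr`); the Kronecker character
`ε_K` exists (`PrintCFram.OffLocusDictionary.exists_isKroneckerCharacterOf`); §8 gives (4); `KrizLiLocusLValueFree` concludes.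

HONEST FRAMING: CONDITIONAL on the displayed named facts (`PrintedFacts`; Kriz–Li 2019 Thm. 1.20 and §8 — PUBLISHED, refereed); per pair the
remaining inputs are arithmetic certificates (a field, two class numbers) plus the character data; nothing is closed; BSD is proved for no
curve.  References: Kriz–Li, Forum Math. Sigma 7 (2019) e15, Thm. 1.20, §8 (35), Lemma 8.2, Cor. 8.3 [KrizLi2019]; Washington Thm. 4.17
[Washington1997]; this seat p741544 (F25b), p742144 (§8 typed).
-/

set_option autoImplicit false
-- `Summit.<P>.<Sub>` repeats `BirchSwinnertonDyer` by the tree's layout convention (D-0017)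
set_option linter.dupNamespace false

noncomputable section

open scoped Classical

open Field NumberField IsDedekindDomain WeierstrassCurve
open Literature.NumberTheory.EllipticCurves Literature.NumberTheory.EllipticCurves.ModularForms
  Literature.NumberTheory.EllipticCurves.Rank1Residual Literature.NumberTheory.EllipticCurves.Rank1Residual.Typed
  Literature.NumberTheory.EllipticCurves.KrizLi2019
  Summit.BirchSwinnertonDyer.Rank1Residual Summit.BirchSwinnertonDyer.BirchSwinnertonDyer.Theorems.SchneiderFree
  Summit.BirchSwinnertonDyer.BirchSwinnertonDyer.Theses.SchneiderFreeAdditiveX3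

namespace Summit.BirchSwinnertonDyer.BirchSwinnertonDyer.Theorems.SchneiderFreeAdditiveX3.KrizLiLocusFieldThreeH3

/-- **The lower half of BSD₃ at a curve of the K1 door from `PrintedFacts`, Kriz–Li 2019 Thm. 1.20 and §8, the character data, a Heegner
field and TWO CLASS NUMBERS.**  For `W/ℚ` globally minimal on the door at `p = 3` (`r_an(W) = 1`, `ClassX3 W 3`, semistable twist), a
quadratic primitive `ψ` of conductor `f` supported on `3N_W` and the Teichmüller `ω` with the trace form and Kriz–Li's Thm. 7.1 (1)–(3), an
imaginary quadratic `K` with odd `d_K` satisfying the Heegner hypothesis for `N_W`, and `3 ∤ h(ℚ(√(f d_K)))·h(ℚ(√(−3f)))` if `ψ` is even,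
`3 ∤ h(ℚ(√(−f)))·h(ℚ(√(3 f d_K)))` if `ψ` is odd (`ThreeClassNumberTrivial`): `MissingLowerBoundAt W 3`.  CONDITIONAL on `hF`, `hKL`, `h83`
(published). [cite: KrizLi2019, Thm. 1.20 (pp. 7–8), §8 (35) / Lemma 8.2 / Cor. 8.3] [cite: Washington1997, Thm. 4.17]
[cite: GrossZagier1986, Thm. I.(6.3) and V.§2] -/
theorem missingLowerBoundAt_three_of_printedFacts_of_thm120_of_heegnerField_h3 (hF : PrintedFacts)
    (hKL : KrizLi2019.thm120_padicLogHeegner_unit_of_bernoulli) (h83 : KrizLi2019.cor83_bernoulli_unit_three_of_h3)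
    (W : WeierstrassCurve ℚ) [W.IsElliptic] [W.IsGloballyMinimal]
    (hr : W.analyticRank = 1) (hX : ClassX3 W 3) (hS : Additive.SubSemistableTwist W 3)
    -- Kriz–Li's character data at `(W, 3)`
    (f : ℕ) [NeZero f] (ψ : DirichletCharacter ℚ_[3] f) (ω : DirichletCharacter ℚ_[3] 3)
    (hψ : ψ.IsPrimitive) (hq : ψ ^ 2 = 1) (hω : KrizLi2019.IsTeichmullerCharacter ω)
    (hfN : ∀ q : ℕ, q.Prime → q ∣ f → q ∣ 3 * W.conductorNorm ℤ)
    (hss : ∀ ℓ : ℕ, ℓ.Prime → ¬ (ℓ ∣ 3 * W.conductorNorm ℤ) →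
      ‖((W.LFunction ℓ : ℤ) : ℚ_[3]) - (ψ (ℓ : ZMod f) + ψ⁻¹ (ℓ : ZMod f) * ω (ℓ : ZMod 3))‖ < 1)
    (h1 : ψ ((3 : ℕ) : ZMod f) ≠ 1) (h1' : KrizLi2019.primVal (KrizLi2019.invMulOmega ψ ω) 3 ≠ 1)
    (h2 : ∀ ℓ : ℕ, (hℓ : ℓ.Prime) → ¬ (haveI := Fact.mk hℓ; W.HasSplitMultiplicativeReductionAtPrime ℓ))
    (h3 : ∀ ℓ : ℕ, (hℓ : ℓ.Prime) → ℓ ≠ 3 →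
      (haveI := Fact.mk hℓ; ¬ W.HasGoodReductionAtPrime ℓ ∧ ¬ W.HasMultiplicativeReductionAtPrime ℓ) →
      ψ (ℓ : ZMod f) ≠ 1 ∧ KrizLi2019.primVal (KrizLi2019.invMulOmega ψ ω) ℓ ≠ 1)
    -- a Heegner field of `N_W` with odd discriminant, and the two class numbers
    (K : Type) [Field K] [NumberField K] (hK : IsImaginaryQuadratic K) (hodd : Odd (NumberField.discr K))
    (hHe : SatisfiesHeegnerHypothesis (W.conductorNorm ℤ) K)
    (hhe : ψ.Even → ThreeClassNumberTrivial ((f : ℤ) * NumberField.discr K) ∧ ThreeClassNumberTrivial (-3 * (f : ℤ)))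
    (hho : ψ.Odd → ThreeClassNumberTrivial (-(f : ℤ)) ∧ ThreeClassNumberTrivial (3 * (f : ℤ) * NumberField.discr K)) :
    MissingLowerBoundAt W 3 := by
  -- `3 ∣ N_W` (additive at `3`) and every prime of `f` divides `3N_W`: they split in `K`, so `3 ∤ d_K` and `(f, d_K) = 1`
  have h3N : 3 ∣ W.conductorNorm ℤ := (W.dvd_conductorNorm_iff_not_hasGoodReductionAtPrime 3).mpr hX.2.1
  have h3d : ¬ ((3 : ℤ) ∣ NumberField.discr K) := by
    simpa using Literature.SatisfiesHeegnerHypothesis.not_dvd_discr hK.1 hHe Nat.prime_three h3N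
  have hcop : Nat.Coprime f (NumberField.discr K).natAbs := by
    refine Nat.coprime_of_dvd fun q hq hqf hqd ↦ ?_
    have hqN : q ∣ W.conductorNorm ℤ := by
      rcases (Nat.Prime.dvd_mul hq).mp (hfN q hq hqf) with hq3 | hqN
      · exact ((Nat.prime_dvd_prime_iff_eq hq Nat.prime_three).mp hq3) ▸ h3N
      · exact hqN
    exact Literature.SatisfiesHeegnerHypothesis.not_dvd_discr hK.1 hHe hq hqN (Int.natCast_dvd.mpr hqd)
  -- the Kronecker character of `K`, and §8: the two class numbers give Thm. 7.1 (4)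
  haveI : NeZero (NumberField.discr K).natAbs := ⟨Int.natAbs_ne_zero.mpr (NumberField.discr_ne_zero K)⟩
  obtain ⟨εK, hεK⟩ := PrintCFram.OffLocusDictionary.exists_isKroneckerCharacterOf (p := 3) hK.1
  have h4 := h83 f ψ ω hψ hq hω h1 h1' K hK hcop h3d εK hεK hhe hho
  exact KrizLiLocusLValueFree.missingLowerBoundAt_of_printedFacts_of_thm120_of_heegnerField hF hKL W 3 hr (by norm_num) hX hS
    f ψ ω hψ hω hss h1 h1' h2 h3 K hK hodd hHe εK hεK h4

end Summit.BirchSwinnertonDyer.BirchSwinnertonDyer.Theorems.SchneiderFreeAdditiveX3.KrizLiLocusFieldThreeH3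

end
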